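import Summits.HubbardSuperconductivity.HubbardSuperconductivity.Theorems.NodalWardXYDefs

/-!
# `PerturbedXYOrder` (stmt-HubbardSuperconductivity-10739) — line `schwarz-inheritance`, stub `stub_e3LocalRigidity`

**Local rigidity** (exponent-3 tightness chain of lead c5).  Notation (inline, as in the whole stub family):
`ι y = fun k => ((y k : ℕ) : ZMod L)` for `y : Fin 3 → Fin (2ⁿ)`, the site current `j_θ(x) = Σ_i cur (x, i) θ`
(`|j_θ| ≤ 3`), and the double block average `(T_n j_θ)(x) = (Σ_{y,y'} j_θ(x + ι y' − ι y)) / 2^(6n)`.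
`stub_e3LocalRigidity`: for every `a > 0` there is `ρ > 0` such that for `n ≥ 2`, every `L ≥ 1` and every
angle field `θ`, if `Σ_x (j_θ − T_n j_θ)² ≤ 9ρL³` and `Σ_x j_θ² ≥ (1 − ρ)·9L³` then
`Σ_{x,y} cos(θ_x − θ_y) < (a/2) L⁶`.

Proof (`ρ = η²`, `η = min (1/4) (a/50)`).
* Step 0 (`lr3_shift_sum_le`, `lr3_T_lipschitz`): writing `Fin 3 → Fin m` as `Fin m × (Fin 2 → Fin m)`
  (`Fin.consEquiv`), a shift of the base point by `e₀ = Pi.single 0 1` telescopes along the first coordinate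
  (`Finset.sum_range_sub`), so `|Σ_{y,y'} j(x + e₀ + ιy' − ιy) − Σ_{y,y'} j(x + ιy' − ιy)| ≤ 6m⁵`, i.e.
  `T_n j_θ` is `6/2ⁿ ≤ 3/2`-Lipschitz along `e₀`.
* Steps 1–6 (`lr3_abstract`, for an abstract `3/2`-Lipschitz comparison function `T`): Chebyshev counting
  (`lr3_card_filter_mul_le`) bounds the weak sites `{j² < 9(1 − η)}` by `ηL³` and the irregular sites
  `{(j − T)² > 1}` by `9η²L³`; at a good site the three currents have a common sign and the `e₀`-current is
  `≥ 1 − 3η` in modulus (`lr3_dichotomy`); two consecutive good sites `x, x + e₀` have the same sign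
  (`|j(x + e₀) − j(x)| ≤ 1 + 3/2 + 1 < 6(1 − η)`), whence `1 + cos(θ_{x+2e₀} − θ_x) ≤ 12η`
  (`lr3_one_add_cos_add_le`); finally `Σ_{x,y} cos(θ_x − θ_y) = (Σ cos θ)² + (Σ sin θ)²`
  (`lr3_sum_cos_sub_eq`), `2Σ cos θ = Σ_x (cos θ_x + cos θ_{x+2e₀})` (translation invariance) and
  Cauchy–Schwarz (`sq_sum_le_card_mul_sum_sq`, `lr3_sq_add_sq_eq`) give
  `Σ_{x,y} cos ≤ (L³/2) Σ_x (1 + cos(θ_{x+2e₀} − θ_x)) ≤ (8η + 18η²) L⁶ ≤ (25/2) η L⁶ ≤ (a/4) L⁶ < (a/2) L⁶`.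
-/

noncomputable section

namespace Summit.HubbardSuperconductivity.HubbardSuperconductivity.Theorems.PerturbedXYOrder

open MeasureTheory Literature.Probability.LatticeModels
open Summit.HubbardSuperconductivity.HubbardSuperconductivity.Theses.NodalWardXY

/-- `Σ_{x,y} cos(θ_x − θ_y) = (Σ_x cos θ_x)² + (Σ_x sin θ_x)²`. -/
theorem lr3_sum_cos_sub_eq {ι : Type*} [Fintype ι] (θ : ι → ℝ) :
    ∑ x, ∑ y, Real.cos (θ x - θ y) = (∑ x, Real.cos (θ x)) ^ 2 + (∑ x, Real.sin (θ x)) ^ 2 := by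
  simp only [Real.cos_sub, Finset.sum_add_distrib, sq, Finset.sum_mul_sum]

/-- `(cos a + cos b)² + (sin a + sin b)² = 2 + 2 cos(b − a)`. -/
theorem lr3_sq_add_sq_eq (a b : ℝ) :
    (Real.cos a + Real.cos b) ^ 2 + (Real.sin a + Real.sin b) ^ 2 = 2 + 2 * Real.cos (b - a) := by
  rw [Real.cos_sub]
  linear_combination (Real.sin_sq_add_cos_sq a) + (Real.sin_sq_add_cos_sq b)

/-- Step 4 trigonometry: if `sin u` and `sin v` are both `≥ 1 − r` or both `≤ −(1 − r)` (`0 ≤ r ≤ 1`), then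
`1 + cos(u + v) ≤ 4r`. -/
theorem lr3_one_add_cos_add_le (r u v : ℝ) (hr1 : r ≤ 1)
    (h : (1 - r ≤ Real.sin u ∧ 1 - r ≤ Real.sin v) ∨ (Real.sin u ≤ -(1 - r) ∧ Real.sin v ≤ -(1 - r))) :
    1 + Real.cos (u + v) ≤ 4 * r := by
  rw [Real.cos_add]
  have hsu := Real.sin_sq_add_cos_sq u
  have hsv := Real.sin_sq_add_cos_sq v
  have hp : (1 - r) ^ 2 ≤ Real.sin u * Real.sin v := by
    rcases h with ⟨hu, hv⟩ | ⟨hu, hv⟩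
    · nlinarith [mul_le_mul hu hv (by linarith) (by linarith : 0 ≤ Real.sin u)]
    · nlinarith [mul_le_mul (neg_le_neg hu) (neg_le_neg hv) (by linarith) (by linarith : 0 ≤ -Real.sin u)]
  have hsu2 : (1 - r) ^ 2 ≤ Real.sin u ^ 2 := by
    rcases h with ⟨hu, _⟩ | ⟨hu, _⟩
    · nlinarith [mul_le_mul hu hu (by linarith) (by linarith : 0 ≤ Real.sin u)]
    · nlinarith [mul_le_mul (neg_le_neg hu) (neg_le_neg hu) (by linarith) (by linarith : 0 ≤ -Real.sin u)]
  have hsv2 : (1 - r) ^ 2 ≤ Real.sin v ^ 2 := by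
    rcases h with ⟨_, hv⟩ | ⟨_, hv⟩
    · nlinarith [mul_le_mul hv hv (by linarith) (by linarith : 0 ≤ Real.sin v)]
    · nlinarith [mul_le_mul (neg_le_neg hv) (neg_le_neg hv) (by linarith) (by linarith : 0 ≤ -Real.sin v)]
  nlinarith [sq_nonneg (Real.cos u - Real.cos v), sq_nonneg r]

/-- Step 2 dichotomy: three numbers in `[−1, 1]` whose sum has square `≥ 9(1 − η)` have sum `≥ 3(1 − η)` with
first entry `≥ 1 − 3η`, or sum `≤ −3(1 − η)` with first entry `≤ −(1 − 3η)`. -/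
theorem lr3_dichotomy (η c₀ c₁ c₂ : ℝ) (h0 : |c₀| ≤ 1) (h1 : |c₁| ≤ 1) (h2 : |c₂| ≤ 1)
    (hsq : 9 * (1 - η) ≤ (c₀ + c₁ + c₂) ^ 2) :
    (3 * (1 - η) ≤ c₀ + c₁ + c₂ ∧ 1 - 3 * η ≤ c₀) ∨
      (c₀ + c₁ + c₂ ≤ -(3 * (1 - η)) ∧ c₀ ≤ -(1 - 3 * η)) := by
  obtain ⟨h0l, h0r⟩ := abs_le.mp h0
  obtain ⟨h1l, h1r⟩ := abs_le.mp h1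
  obtain ⟨h2l, h2r⟩ := abs_le.mp h2
  rcases le_or_gt 0 (c₀ + c₁ + c₂) with hs | hs
  · left
    have : 3 * (1 - η) ≤ c₀ + c₁ + c₂ := by
      nlinarith [mul_nonneg hs (by linarith : 0 ≤ 3 - (c₀ + c₁ + c₂))]
    exact ⟨this, by linarith⟩
  · right
    have : c₀ + c₁ + c₂ ≤ -(3 * (1 - η)) := by
      nlinarith [mul_nonneg (by linarith : 0 ≤ -(c₀ + c₁ + c₂)) (by linarith : 0 ≤ 3 + (c₀ + c₁ + c₂))]
    exact ⟨this, by linarith⟩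

/-- Markov counting on a finite type: if `f ≥ 0` and `f ≥ t` wherever `p` holds, then `#{p} · t ≤ Σ f`. -/
theorem lr3_card_filter_mul_le {ι : Type*} [Fintype ι] (f : ι → ℝ) (hf : ∀ i, 0 ≤ f i) (t : ℝ)
    (p : ι → Prop) [DecidablePred p] (hp : ∀ i, p i → t ≤ f i) :
    ((Finset.univ.filter p).card : ℝ) * t ≤ ∑ i, f i := by
  calc ((Finset.univ.filter p).card : ℝ) * t = ∑ _i ∈ Finset.univ.filter p, t := by
        rw [Finset.sum_const, nsmul_eq_mul]
    _ ≤ ∑ i ∈ Finset.univ.filter p, f i :=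
        Finset.sum_le_sum fun i hi => hp i (Finset.mem_filter.1 hi).2
    _ ≤ ∑ i, f i :=
        Finset.sum_le_sum_of_subset_of_nonneg (Finset.filter_subset _ _) (fun i _ _ => hf i)

/-- Step 0 core: shifting the base point of a cube sum `Σ_{y ∈ Q_m} G(w + ι y)` by `e₀` changes it by at most two
boundary slabs: `|Σ_y G(w + e₀ + ι y) − Σ_y G(w + ι y)| ≤ 2 B m²` when `|G| ≤ B`. -/
theorem lr3_shift_sum_le {L : ℕ} (m : ℕ) (G : TorusSite 3 L → ℝ) (B : ℝ) (hG : ∀ z, |G z| ≤ B)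
    (w : TorusSite 3 L) :
    |(∑ y : Fin 3 → Fin m, G (w + Pi.single 0 1 + fun k => ((y k : ℕ) : ZMod L))) -
        ∑ y : Fin 3 → Fin m, G (w + fun k => ((y k : ℕ) : ZMod L))| ≤ 2 * B * (m : ℝ) ^ 2 := by
  have key : ∀ H : (Fin 3 → Fin m) → ℝ,
      ∑ y, H y = ∑ z : Fin 2 → Fin m, ∑ a : Fin m, H (Fin.cons a z) := by
    intro H
    rw [← (Fin.consEquiv (fun _ : Fin 3 => Fin m)).sum_comp, Fintype.sum_prod_type, Finset.sum_comm]
    rfl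
  rw [key, key, ← Finset.sum_sub_distrib]
  have hcard : ((Finset.univ : Finset (Fin 2 → Fin m)).card : ℝ) = (m : ℝ) ^ 2 := by
    rw [Finset.card_univ, Fintype.card_fun, Fintype.card_fin, Fintype.card_fin]
    push_cast
    rfl
  calc _ ≤ ∑ z : Fin 2 → Fin m, |(∑ a : Fin m, G (w + Pi.single 0 1 + fun k =>
              (((Fin.cons a z : Fin 3 → Fin m) k : ℕ) : ZMod L))) -
            ∑ a : Fin m, G (w + fun k => (((Fin.cons a z : Fin 3 → Fin m) k : ℕ) : ZMod L))| :=
          Finset.abs_sum_le_sum_abs _ _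
    _ ≤ ∑ _z : Fin 2 → Fin m, 2 * B := Finset.sum_le_sum (fun z _ => ?_)
    _ = 2 * B * (m : ℝ) ^ 2 := by rw [Finset.sum_const, nsmul_eq_mul, hcard]; ring
  -- the 1D telescoping for fixed `z`
  set v : TorusSite 3 L := Fin.cons (0 : ZMod L) (fun k' : Fin 2 => ((z k' : ℕ) : ZMod L)) with hv
  set h : ℕ → ℝ := fun t => G (w + v + ((t : ℕ) : ZMod L) • (Pi.single 0 1 : TorusSite 3 L)) with hh
  have hι : ∀ a : Fin m, (fun k => (((Fin.cons a z : Fin 3 → Fin m) k : ℕ) : ZMod L)) =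
      v + ((a : ℕ) : ZMod L) • (Pi.single 0 1 : TorusSite 3 L) := by
    intro a
    funext k
    refine Fin.cases ?_ (fun k' => ?_) k
    · simp [v]
    · simp [v, Fin.succ_ne_zero]
  have h1 : ∀ a : Fin m, G (w + Pi.single 0 1 + fun k => (((Fin.cons a z : Fin 3 → Fin m) k : ℕ) : ZMod L)) =
      h ((a : ℕ) + 1) := by
    intro a
    rw [hι a, hh]
    simp only
    congr 1
    rw [Nat.cast_succ, add_smul, one_smul]
    abel
  have h2 : ∀ a : Fin m, G (w + fun k => (((Fin.cons a z : Fin 3 → Fin m) k : ℕ) : ZMod L)) = h (a : ℕ) := by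
    intro a
    rw [hι a, ← add_assoc]
  simp_rw [h1, h2]
  rw [Fin.sum_univ_eq_sum_range (fun i => h (i + 1)) m, Fin.sum_univ_eq_sum_range h m,
    ← Finset.sum_sub_distrib, Finset.sum_range_sub]
  calc |h m - h 0| ≤ |h m| + |h 0| := abs_sub _ _
    _ ≤ B + B := add_le_add (hG _) (hG _)
    _ = 2 * B := by ring

/-- Step 0: the double block sum `Σ_y Σ_{y'} j_θ(x + ι y' − ι y)` changes by at most `6 m⁵` when `x` is shifted by
`e₀` (it is `Σ_{y'} F(x + ι y')` with `F(w) = Σ_y j_θ(w − ι y)`, `|F| ≤ 3m³`; then `lr3_shift_sum_le`). -/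
theorem lr3_T_lipschitz {L : ℕ} (θ : TorusSite 3 L → ℝ) (m : ℕ) (x : TorusSite 3 L) :
    |(∑ y : Fin 3 → Fin m, ∑ y' : Fin 3 → Fin m, ∑ i : Fin 3,
        cur (x + Pi.single 0 1 + (fun k => ((y' k : ℕ) : ZMod L)) - (fun k => ((y k : ℕ) : ZMod L)), i) θ) -
      ∑ y : Fin 3 → Fin m, ∑ y' : Fin 3 → Fin m, ∑ i : Fin 3,
        cur (x + (fun k => ((y' k : ℕ) : ZMod L)) - (fun k => ((y k : ℕ) : ZMod L)), i) θ| ≤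
      6 * (m : ℝ) ^ 5 := by
  set F : TorusSite 3 L → ℝ := fun w => ∑ y : Fin 3 → Fin m, ∑ i : Fin 3,
    cur (w - (fun k => ((y k : ℕ) : ZMod L)), i) θ with hF
  have hA : (∑ y : Fin 3 → Fin m, ∑ y' : Fin 3 → Fin m, ∑ i : Fin 3,
        cur (x + Pi.single 0 1 + (fun k => ((y' k : ℕ) : ZMod L)) - (fun k => ((y k : ℕ) : ZMod L)), i) θ) =
      ∑ y' : Fin 3 → Fin m, F (x + Pi.single 0 1 + fun k => ((y' k : ℕ) : ZMod L)) := by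
    rw [Finset.sum_comm]
  have hB : (∑ y : Fin 3 → Fin m, ∑ y' : Fin 3 → Fin m, ∑ i : Fin 3,
        cur (x + (fun k => ((y' k : ℕ) : ZMod L)) - (fun k => ((y k : ℕ) : ZMod L)), i) θ) =
      ∑ y' : Fin 3 → Fin m, F (x + fun k => ((y' k : ℕ) : ZMod L)) := by
    rw [Finset.sum_comm]
  have hcard : ((Finset.univ : Finset (Fin 3 → Fin m)).card : ℝ) = (m : ℝ) ^ 3 := by
    rw [Finset.card_univ, Fintype.card_fun, Fintype.card_fin, Fintype.card_fin]
    push_cast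
    rfl
  have hj : ∀ w : TorusSite 3 L, |∑ i : Fin 3, cur (w, i) θ| ≤ 3 := by
    intro w
    calc _ ≤ ∑ i : Fin 3, |cur (w, i) θ| := Finset.abs_sum_le_sum_abs _ _
      _ ≤ ∑ _i : Fin 3, (1 : ℝ) := Finset.sum_le_sum fun i _ => Real.abs_sin_le_one _
      _ = 3 := by simp
  have hFb : ∀ w, |F w| ≤ 3 * (m : ℝ) ^ 3 := by
    intro w
    calc _ ≤ ∑ y : Fin 3 → Fin m, |∑ i : Fin 3, cur (w - (fun k => ((y k : ℕ) : ZMod L)), i) θ| :=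
          Finset.abs_sum_le_sum_abs _ _
      _ ≤ ∑ _y : Fin 3 → Fin m, (3 : ℝ) := Finset.sum_le_sum fun y _ => hj _
      _ = 3 * (m : ℝ) ^ 3 := by rw [Finset.sum_const, nsmul_eq_mul, hcard]; ring
  rw [hA, hB]
  calc _ ≤ 2 * (3 * (m : ℝ) ^ 3) * (m : ℝ) ^ 2 := lr3_shift_sum_le m F _ hFb x
    _ = 6 * (m : ℝ) ^ 5 := by ring

/-- Steps 1–6 of the rigidity argument for an abstract comparison function `T` that is `3/2`-Lipschitz along
`e₀`: if `j_θ` is `ℓ²`-close to `T` and has near-maximal `ℓ²` norm (parameter `ρ = η²`, `η ≤ 1/4`), then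
`Σ_{x,y} cos(θ_x − θ_y) ≤ (25/2) η L⁶`.  (Chebyshev counting of weak/irregular sites, sign propagation
along `e₀`, pairing `x` with `x + 2e₀`, Cauchy–Schwarz.) -/
theorem lr3_abstract {L : ℕ} [NeZero L] (θ : TorusSite 3 L → ℝ) (η : ℝ) (hη0 : 0 < η) (hη1 : η ≤ 1 / 4)
    (T : TorusSite 3 L → ℝ) (hlip : ∀ x, |T (x + Pi.single 0 1) - T x| ≤ 3 / 2)
    (hT : ∑ x : TorusSite 3 L, ((∑ i : Fin 3, cur (x, i) θ) - T x) ^ 2 ≤ 9 * η ^ 2 * (L : ℝ) ^ 3)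
    (hJ : (1 - η ^ 2) * (9 * (L : ℝ) ^ 3) ≤ ∑ x : TorusSite 3 L, (∑ i : Fin 3, cur (x, i) θ) ^ 2) :
    ∑ x : TorusSite 3 L, ∑ y : TorusSite 3 L, Real.cos (θ x - θ y) ≤ 25 / 2 * η * (L : ℝ) ^ 6 := by
  classical
  set e₀ : TorusSite 3 L := Pi.single 0 1 with he₀
  set j : TorusSite 3 L → ℝ := fun x => ∑ i : Fin 3, cur (x, i) θ with hj
  have hN : ((Finset.univ : Finset (TorusSite 3 L)).card : ℝ) = (L : ℝ) ^ 3 := by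
    rw [Finset.card_univ, Fintype.card_fun, ZMod.card, Fintype.card_fin]
    push_cast
    rfl
  have hcur : ∀ b : Bond L, |cur b θ| ≤ 1 := fun b => Real.abs_sin_le_one _
  have hj9 : ∀ x, (j x) ^ 2 ≤ 9 := by
    intro x
    have h3 : |j x| ≤ 3 := by
      calc _ ≤ ∑ i : Fin 3, |cur (x, i) θ| := Finset.abs_sum_le_sum_abs _ _
        _ ≤ ∑ _i : Fin 3, (1 : ℝ) := Finset.sum_le_sum fun i _ => hcur _
        _ = 3 := by simp
    obtain ⟨h3l, h3r⟩ := abs_le.mp h3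
    nlinarith
  -- the good sites: strong current, close to `T`
  let good : TorusSite 3 L → Prop := fun x => 9 * (1 - η) ≤ (j x) ^ 2 ∧ (j x - T x) ^ 2 ≤ 1
  -- Step 1: Chebyshev counting of the bad sites
  set Bad₁ := Finset.univ.filter (fun x : TorusSite 3 L => ¬ (9 * (1 - η) ≤ (j x) ^ 2)) with hBad₁
  set Bad₂ := Finset.univ.filter (fun x : TorusSite 3 L => ¬ ((j x - T x) ^ 2 ≤ 1)) with hBad₂
  have hB1 : (Bad₁.card : ℝ) ≤ η * (L : ℝ) ^ 3 := by
    have h1 : (Bad₁.card : ℝ) * (9 * η) ≤ ∑ x, (9 - (j x) ^ 2) :=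
      lr3_card_filter_mul_le (fun x => 9 - (j x) ^ 2) (fun x => by linarith [hj9 x]) (9 * η) _
        (fun x hx => by linarith [not_le.mp hx])
    have h2 : ∑ x, (9 - (j x) ^ 2) = 9 * (L : ℝ) ^ 3 - ∑ x, (j x) ^ 2 := by
      rw [Finset.sum_sub_distrib, Finset.sum_const, nsmul_eq_mul, hN, mul_comm]
    rw [h2] at h1
    have h3 : (Bad₁.card : ℝ) * (9 * η) ≤ η * (L : ℝ) ^ 3 * (9 * η) := by nlinarith
    exact le_of_mul_le_mul_right h3 (by positivity)
  have hB2 : (Bad₂.card : ℝ) ≤ 9 * η ^ 2 * (L : ℝ) ^ 3 := by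
    have h1 : (Bad₂.card : ℝ) * 1 ≤ ∑ x, (j x - T x) ^ 2 :=
      lr3_card_filter_mul_le (fun x => (j x - T x) ^ 2) (fun x => sq_nonneg _) 1 _
        (fun x hx => (not_le.mp hx).le)
    linarith
  set Sbad := Finset.univ.filter (fun x : TorusSite 3 L => ¬ good x) with hSbad
  have hSb : (Sbad.card : ℝ) ≤ (η + 9 * η ^ 2) * (L : ℝ) ^ 3 := by
    have hsub : Sbad ⊆ Bad₁ ∪ Bad₂ := by
      intro x hx
      simp only [Sbad, Bad₁, Bad₂, good, Finset.mem_filter, Finset.mem_univ, true_and,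
        Finset.mem_union] at hx ⊢
      tauto
    have h1 := (Finset.card_le_card hsub).trans (Finset.card_union_le _ _)
    have h2 : (Sbad.card : ℝ) ≤ Bad₁.card + Bad₂.card := by exact_mod_cast h1
    linarith
  -- good pairs `(x, x + e₀)` and their complement
  let P : TorusSite 3 L → Prop := fun x => good x ∧ good (x + e₀)
  set G := Finset.univ.filter P with hG
  set Gc := Finset.univ.filter (fun x : TorusSite 3 L => ¬ P x) with hGc
  have hGcb : (Gc.card : ℝ) ≤ 2 * ((η + 9 * η ^ 2) * (L : ℝ) ^ 3) := by
    set S2 := Finset.univ.filter (fun x : TorusSite 3 L => ¬ good (x + e₀)) with hS2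
    have hsub : Gc ⊆ Sbad ∪ S2 := by
      intro x hx
      simp only [Gc, Sbad, S2, P, Finset.mem_filter, Finset.mem_univ, true_and, Finset.mem_union] at hx ⊢
      tauto
    have hS2sub : S2 ⊆ Sbad.image (fun z => z - e₀) := by
      intro x hx
      simp only [S2, Sbad, Finset.mem_filter, Finset.mem_univ, true_and, Finset.mem_image] at hx ⊢
      exact ⟨x + e₀, hx, add_sub_cancel_right x e₀⟩
    have h1 := (Finset.card_le_card hsub).trans (Finset.card_union_le _ _)
    have h2 := (Finset.card_le_card hS2sub).trans Finset.card_image_le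
    have h3 : (Gc.card : ℝ) ≤ Sbad.card + Sbad.card := by
      exact_mod_cast h1.trans (Nat.add_le_add_left h2 _)
    linarith
  -- Steps 2–4: on a good pair, `1 + cos(θ_{x+2e₀} − θ_x) ≤ 12 η`
  have hA : ∀ x ∈ G, 1 + Real.cos (θ (x + e₀ + e₀) - θ x) ≤ 12 * η := by
    intro x hx
    simp only [G, P, good, Finset.mem_filter, Finset.mem_univ, true_and] at hx
    obtain ⟨⟨hx1, hx2⟩, hx1', hx2'⟩ := hx
    obtain ⟨d1, d1'⟩ := abs_le.mp ((sq_le_one_iff_abs_le_one _).mp hx2)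
    obtain ⟨d2, d2'⟩ := abs_le.mp ((sq_le_one_iff_abs_le_one _).mp hx2')
    obtain ⟨d3, d3'⟩ := abs_le.mp (hlip x)
    have hw : θ (x + e₀ + e₀) - θ x = (θ (x + e₀) - θ x) + (θ (x + e₀ + e₀) - θ (x + e₀)) := by ring
    rw [hw]
    have hu : cur (x, 0) θ = Real.sin (θ (x + e₀) - θ x) := rfl
    have hv : cur (x + e₀, 0) θ = Real.sin (θ (x + e₀ + e₀) - θ (x + e₀)) := rfl
    have key := lr3_one_add_cos_add_le (3 * η) (θ (x + e₀) - θ x) (θ (x + e₀ + e₀) - θ (x + e₀))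
      (by linarith)
    rw [← hu, ← hv] at key
    simp only [j, Fin.sum_univ_three] at hx1 hx1' d1 d1' d2 d2'
    rcases lr3_dichotomy η (cur (x, 0) θ) (cur (x, 1) θ) (cur (x, 2) θ) (hcur _) (hcur _) (hcur _) hx1
      with ⟨hs, hc⟩ | ⟨hs, hc⟩ <;>
    rcases lr3_dichotomy η (cur (x + e₀, 0) θ) (cur (x + e₀, 1) θ) (cur (x + e₀, 2) θ) (hcur _)
      (hcur _) (hcur _) hx1' with ⟨hs', hc'⟩ | ⟨hs', hc'⟩
    · linarith [key (Or.inl ⟨hc, hc'⟩)]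
    · exfalso
      linarith
    · exfalso
      linarith
    · linarith [key (Or.inr ⟨hc, hc'⟩)]
  -- Step 5: the paired sum
  have hsumw : ∑ x, (1 + Real.cos (θ (x + e₀ + e₀) - θ x)) ≤ (16 * η + 36 * η ^ 2) * (L : ℝ) ^ 3 := by
    rw [← Finset.sum_filter_add_sum_filter_not Finset.univ P]
    have h1 : ∑ x ∈ G, (1 + Real.cos (θ (x + e₀ + e₀) - θ x)) ≤ G.card • (12 * η) :=
      Finset.sum_le_card_nsmul _ _ _ hA
    have h2 : ∑ x ∈ Gc, (1 + Real.cos (θ (x + e₀ + e₀) - θ x)) ≤ Gc.card • (2 : ℝ) :=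
      Finset.sum_le_card_nsmul _ _ _ (fun x _ => by linarith [Real.cos_le_one (θ (x + e₀ + e₀) - θ x)])
    rw [nsmul_eq_mul] at h1 h2
    have hGle : (G.card : ℝ) ≤ (L : ℝ) ^ 3 := by
      rw [← hN]
      exact_mod_cast Finset.card_filter_le _ _
    have h3 : (G.card : ℝ) * (12 * η) ≤ (L : ℝ) ^ 3 * (12 * η) :=
      mul_le_mul_of_nonneg_right hGle (by positivity)
    linarith
  -- Step 6: Cauchy–Schwarz and the magnetisation identity
  have hshift : ∀ f : TorusSite 3 L → ℝ, ∑ x, f (x + e₀ + e₀) = ∑ x, f x := by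
    intro f
    have h1 : ∑ x, f (x + e₀ + e₀) = ∑ x, f (x + e₀) :=
      Equiv.sum_comp (Equiv.addRight e₀) (fun x => f (x + e₀))
    rw [h1]
    exact Equiv.sum_comp (Equiv.addRight e₀) f
  have hC := sq_sum_le_card_mul_sum_sq (s := (Finset.univ : Finset (TorusSite 3 L)))
    (f := fun x => Real.cos (θ x) + Real.cos (θ (x + e₀ + e₀)))
  have hS := sq_sum_le_card_mul_sum_sq (s := (Finset.univ : Finset (TorusSite 3 L)))
    (f := fun x => Real.sin (θ x) + Real.sin (θ (x + e₀ + e₀)))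
  rw [hN] at hC hS
  have h2C : ∑ x, (Real.cos (θ x) + Real.cos (θ (x + e₀ + e₀))) = 2 * ∑ x, Real.cos (θ x) := by
    rw [Finset.sum_add_distrib, hshift (fun x => Real.cos (θ x))]
    ring
  have h2S : ∑ x, (Real.sin (θ x) + Real.sin (θ (x + e₀ + e₀))) = 2 * ∑ x, Real.sin (θ x) := by
    rw [Finset.sum_add_distrib, hshift (fun x => Real.sin (θ x))]
    ring
  rw [h2C] at hC
  rw [h2S] at hS
  have hsq : ∑ x, ((Real.cos (θ x) + Real.cos (θ (x + e₀ + e₀))) ^ 2 +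
      (Real.sin (θ x) + Real.sin (θ (x + e₀ + e₀))) ^ 2) =
      2 * ∑ x, (1 + Real.cos (θ (x + e₀ + e₀) - θ x)) := by
    rw [Finset.mul_sum]
    refine Finset.sum_congr rfl fun x _ => ?_
    rw [lr3_sq_add_sq_eq]
    ring
  rw [lr3_sum_cos_sub_eq]
  have h4 : 4 * ((∑ x, Real.cos (θ x)) ^ 2 + (∑ x, Real.sin (θ x)) ^ 2) ≤
      (L : ℝ) ^ 3 * (2 * ((16 * η + 36 * η ^ 2) * (L : ℝ) ^ 3)) := by
    calc 4 * ((∑ x, Real.cos (θ x)) ^ 2 + (∑ x, Real.sin (θ x)) ^ 2)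
        = (2 * ∑ x, Real.cos (θ x)) ^ 2 + (2 * ∑ x, Real.sin (θ x)) ^ 2 := by ring
      _ ≤ (L : ℝ) ^ 3 * ∑ x, (Real.cos (θ x) + Real.cos (θ (x + e₀ + e₀))) ^ 2 +
          (L : ℝ) ^ 3 * ∑ x, (Real.sin (θ x) + Real.sin (θ (x + e₀ + e₀))) ^ 2 := add_le_add hC hS
      _ = (L : ℝ) ^ 3 * (2 * ∑ x, (1 + Real.cos (θ (x + e₀ + e₀) - θ x))) := by
          rw [← mul_add, ← Finset.sum_add_distrib, hsq]
      _ ≤ (L : ℝ) ^ 3 * (2 * ((16 * η + 36 * η ^ 2) * (L : ℝ) ^ 3)) := by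
          have : (0 : ℝ) ≤ (L : ℝ) ^ 3 := by positivity
          nlinarith
  have hL6 : (0 : ℝ) ≤ (L : ℝ) ^ 6 := by positivity
  have h5 : (8 * η + 18 * η ^ 2) * (L : ℝ) ^ 6 ≤ 25 / 2 * η * (L : ℝ) ^ 6 := by
    apply mul_le_mul_of_nonneg_right _ hL6
    nlinarith
  have h6 : (L : ℝ) ^ 3 * (2 * ((16 * η + 36 * η ^ 2) * (L : ℝ) ^ 3)) =
      4 * ((8 * η + 18 * η ^ 2) * (L : ℝ) ^ 6) := by ring
  linarith

/-- **Local rigidity** (exponent-3 tightness, line `schwarz-inheritance`): for every `a > 0` there is `ρ > 0`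
such that, for `n ≥ 2`, if the site current `j_θ = Σ_i cur(·, i) θ` is `ℓ²`-close to its double `2ⁿ`-block
average `T_n j_θ` (`Σ (j − T j)² ≤ 9ρL³`) and has near-maximal norm (`Σ j² ≥ (1 − ρ) 9L³`), then the
configuration is demagnetised: `Σ_{x,y} cos(θ_x − θ_y) < (a/2) L⁶`.  Proof: `ρ = η²` with
`η = min (1/4) (a/50)`; `T_n j_θ` is `6/2ⁿ ≤ 3/2`-Lipschitz along `e₀` (`lr3_T_lipschitz`), and
`lr3_abstract` gives `Σ_{x,y} cos ≤ (25/2) η L⁶ ≤ (a/4) L⁶ < (a/2) L⁶`. -/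
theorem stub_e3LocalRigidity (a : ℝ) (ha : 0 < a) :
    ∃ ρ : ℝ, 0 < ρ ∧ ∀ (L : ℕ) [NeZero L] (θ : TorusSite 3 L → ℝ) (n : ℕ), 2 ≤ n →
      (∑ x : TorusSite 3 L, ((∑ i : Fin 3, cur (x, i) θ) - ((∑ y : Fin 3 → Fin (2 ^ n), ∑ y' : Fin 3 → Fin (2 ^ n), ∑ i : Fin 3, cur (x + (fun k => ((y' k : ℕ) : ZMod L)) - (fun k => ((y k : ℕ) : ZMod L)), i) θ) / (2 : ℝ) ^ (6 * n))) ^ 2 ≤ 9 * ρ * (L : ℝ) ^ 3) →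
      ((1 - ρ) * (9 * (L : ℝ) ^ 3) ≤ ∑ x : TorusSite 3 L, (∑ i : Fin 3, cur (x, i) θ) ^ 2) →
      (∑ x : TorusSite 3 L, ∑ y : TorusSite 3 L, Real.cos (θ x - θ y)) < a / 2 * (L : ℝ) ^ 6 := by
  set η : ℝ := min (1 / 4) (a / 50) with hη
  have hη0 : 0 < η := lt_min (by norm_num) (by positivity)
  have hη1 : η ≤ 1 / 4 := min_le_left _ _
  have hη2 : η ≤ a / 50 := min_le_right _ _
  refine ⟨η ^ 2, by positivity, ?_⟩
  intro L _ θ n hn hT hJ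
  have hm4 : (4 : ℝ) ≤ ((2 ^ n : ℕ) : ℝ) := by
    have : 2 ^ 2 ≤ 2 ^ n := Nat.pow_le_pow_right (by norm_num) hn
    exact_mod_cast this
  have hpow : (2 : ℝ) ^ (6 * n) = ((2 ^ n : ℕ) : ℝ) ^ 6 := by
    push_cast
    rw [← pow_mul, mul_comm]
  have hlip : ∀ x : TorusSite 3 L,
      |(∑ y : Fin 3 → Fin (2 ^ n), ∑ y' : Fin 3 → Fin (2 ^ n), ∑ i : Fin 3,
          cur (x + Pi.single 0 1 + (fun k => ((y' k : ℕ) : ZMod L)) - (fun k => ((y k : ℕ) : ZMod L)), i) θ) /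
            (2 : ℝ) ^ (6 * n) -
        (∑ y : Fin 3 → Fin (2 ^ n), ∑ y' : Fin 3 → Fin (2 ^ n), ∑ i : Fin 3,
          cur (x + (fun k => ((y' k : ℕ) : ZMod L)) - (fun k => ((y k : ℕ) : ZMod L)), i) θ) /
            (2 : ℝ) ^ (6 * n)| ≤ 3 / 2 := by
    intro x
    rw [← sub_div, abs_div, abs_of_pos (by positivity : (0 : ℝ) < (2 : ℝ) ^ (6 * n)),
      div_le_iff₀ (by positivity), hpow]
    calc _ ≤ 6 * ((2 ^ n : ℕ) : ℝ) ^ 5 := lr3_T_lipschitz θ (2 ^ n) x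
      _ ≤ 3 / 2 * ((2 ^ n : ℕ) : ℝ) ^ 6 := by
        have h5 : (0 : ℝ) ≤ ((2 ^ n : ℕ) : ℝ) ^ 5 := by positivity
        nlinarith [mul_nonneg h5 (sub_nonneg.mpr hm4)]
  have key := lr3_abstract θ η hη0 hη1 (fun x => (∑ y : Fin 3 → Fin (2 ^ n), ∑ y' : Fin 3 → Fin (2 ^ n),
      ∑ i : Fin 3, cur (x + (fun k => ((y' k : ℕ) : ZMod L)) - (fun k => ((y k : ℕ) : ZMod L)), i) θ) /
        (2 : ℝ) ^ (6 * n)) hlip hT hJ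
  have hL : (1 : ℝ) ≤ (L : ℝ) := by exact_mod_cast NeZero.one_le
  have hL6 : (0 : ℝ) < (L : ℝ) ^ 6 := by positivity
  calc _ ≤ 25 / 2 * η * (L : ℝ) ^ 6 := key
    _ < a / 2 * (L : ℝ) ^ 6 := by
      apply mul_lt_mul_of_pos_right _ hL6
      linarith

end Summit.HubbardSuperconductivity.HubbardSuperconductivity.Theorems.PerturbedXYOrder

end
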